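import Summits.QuantumFields.BalabanUV.T4Continuum.Spine.NE1p.DressedSmallFieldMixedDerivativeSplit
import Summits.QuantumFields.BalabanUV.T4Continuum.Spine.NE1p.DressedSmallFieldMixedDerivativeLetterLocal

/-!
# T⁴ programme, spine estimate NE1′ (node O3b/H2) — THE FTC AND THE SPLIT ON PRINT's ANALYTICITY DOMAIN: the LOCAL versions of W62 and W70 —
# for a factor analytic on the OPEN POLYDISC `Π_j {|z_j| < R_j}`, `R_j > 1` only (print's «analytic function … for |s(Y₀)| ≤ e^{κ₁}», p. 6),
# `∫_{[0,1]^S} ∂_{enumS S} F = Δ_S F`; with contour radii `1 < r_j < R_j` the three kernel routes commute LOCALLY, and W43's `mixedLetter_rep_local`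
# is RE-DERIVED from W57 + the local FTC + W70's split

Cell `pub-balaban`, sub-cell `t4`, row NE1′ formalisation crew (`t4/formal/NE1p/LEAVES.md` row W⟨next⟩ — own-initiative DICTIONARY∕BRIDGE follower of
the unit's W62∕W70 under typer R-T61 (ii): the «LOCAL version = W57 pattern, NOT claimed» left open in W62's and W70's headers), unit
`b2b-balaban-t4-ne1p-formalise-leaf-08` (gen 12).  ADDITIVE — imports W70 `Spine/NE1p/DressedSmallFieldMixedDerivativeSplit` + W57
`Spine/NE1p/DressedSmallFieldMixedDerivativeLetterLocal` ONLY (→ W62 `sS`∕`cubePt`∕`cubePt_cons`∕`norm_cubePt_le`∕`continuous_cubePt`; W70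
`integral_μS_eq_integral_sS_θS`∕`wS_pairθ_interp`∕`σS_pairθ`∕`cubePt_ae_eq_basePt`; W57 `isOpen_polyBall`∕`analyticOnNhd_cons_section_local`∕`basePt_mem_pi`∕
`differentiableOn_mixedDeriv_cons`∕`mixedDerivLetter_rep_local`∕`analyticOnNhd_inv_four_sub`∕`not_analyticOnNhd_univ_inv_four_sub`; W55 `enumS`∕`basePt`∕
`mixedDeriv_enumS_zero`∕`_succ_of_mem`∕`_succ_of_not_mem`∕`θS`∕`pairθ`; W43 `continuous_σS`∕`σS_mem_pi`; W39.1 `μS`∕`wS`∕`σS`∕`mixedDiff`∕`mixedDiff_pair`∕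
`measurable_wS`∕`norm_σS_le`∕`norm_wS_le`; the substrate's `interp`∕`w₁`∕`wB₁`; the Literature module `Dimock2011to13/PolydiscCauchyBounds`: `mixedDeriv`,
`analyticOnNhd_mixedDeriv` — all BY NAME).  THEOREMS ONLY + two decided `example`s; 0 `def`, 0 `instance`, 0 `def … : Prop`, 0 cite, 0 sorry,
0 `attribute`; nothing upstream restated.

WHY THIS FILE.  [Balaban1988RGII] p. 6, last paragraph: the integrand of (1.23) is «an analytic function of s(Y₀), B, for |s(Y₀)| ≤ e^{κ₁}»; p. 15:
the term (2.14) is considered «as an analytic function of (𝐔, 𝐉) in the space 𝐔ᶜ_{k+1}(X, α₀, α₁), and of the complex parameters σ(Z), τ» — LOCI of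
the audited manuscript, TYPE∕CONTEXT only: analyticity on a NEIGHBOURHOOD of the closed polydisc carrying the contours, not on all of `ℂⁿ`.  W62's
FTC `integral_mixedDeriv_cubePt_eq_mixedDiff` and W70's commuting-routes corollaries were stated for JOINTLY ENTIRE `F` and said so; W57 had already
localised W55's angular representation.  This file closes the local column:
* §1 plumbing on the open polydisc `Π_j {|z_j| < R_j}`, `R_j > 1`: `cubePt_mem_pi` (the clamped point lies inside), `continuous_mixedDeriv_cubePt_local`,
  `integrable_mixedDeriv_cubePt_local` (Dimock's `∂_{enumS S} F` is analytic on the OPEN polydisc — `analyticOnNhd_mixedDeriv` BY NAME — hence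
  continuous there; the clamped point ranges in the compact CLOSED UNIT polydisc inside it);
* §2 **`integral_mixedDeriv_cubePt_eq_mixedDiff_local`**: for `F` analytic on the open polydisc ONLY, `∫ ∂_{enumS S} F (cubePt S s) d(⨂ sS S) = Δ_S F`
  — W62's induction along `Fin.cons` with LOCAL tools: the head section `z ↦ ∂_{enumS S′}(F(z ∷ ·))(p′)` is holomorphic on the head DISC `|z| < R₀`
  (W57 `differentiableOn_mixedDeriv_cons`), which contains the real segment `[0,1]`, so the one-variable FTC runs on it (`HasDerivAt.comp_ofReal`;
  continuity of the derivative from `DifferentiableOn.contDiffOn` on the open disc); the sections `F(1 ∷ ·)`, `F(0 ∷ ·)` are analytic on the tail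
  polydisc (W57 `analyticOnNhd_cons_section_local`, `‖1‖, ‖0‖ < R₀`); the unclamped form `…_basePt_…_local` by W70's `cubePt_ae_eq_basePt`;
* §3 the LOCAL commuting routes, radii `1 < r_j < R_j`: **`angularLetter_eq_mixedDeriv_cubePt_local`** (W57 `mixedDerivLetter_rep_local` ONCE at
  `interp ∘ s`, every `s ∈ ℝⁿ`), `integrable_letter_local`, **`mixedLetter_eq_integral_mixedDeriv'_local`** (W70's split `integral_μS_eq_integral_sS_θS`
  ONCE), **`mixedLetter_rep_of_split_local`**: `∫ wS·F∘σS d(⨂ μS S) = Δ_S F` for `F` analytic on the open polydisc — the statement of W43's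
  `mixedLetter_rep_local` (there for `F` ℂ-differentiable on the polydisc, by W39.1's cube-by-cube induction), here from W57 + §2 + the split;
  CENSUS: `mixedLetter_rep_local` ×0, `mixedLetter_rep` ×0, W62's entire FTC ×0 in this file;
* §4 decided `example`s on W57's NON-ENTIRE factor `(4 − z₀z₁)⁻¹` (analytic on the polydisc of radius `2`, NOT entire —
  `not_analyticOnNhd_univ_inv_four_sub`): `∫_{[0,1]²} ∂₀∂₁ (4 − s₀s₁)⁻¹ ds = Δ_{01} = 1∕3 − 1∕4 − (1∕4 − 1∕4) = 1∕12` (§2 + W39.1 `mixedDiff_pair`),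
  and the full iterated letter at contour radii `3∕2`: `∫ ds ∮∮ wS·(4 − σ₀σ₁)⁻¹ = 1∕12` (§3) — where W62∕W70's entire theorems are silent.

HONEST FRAMING.  [folklore] analysis (the one-variable FTC on a holomorphic section, Fubini through W70's measurable equivalence, compactness of the
closed unit polydisc inside the open one) on OUR dictionary objects and the template lineage's kernel object `PolydiscCauchyBounds.mixedDeriv` BY NAME;
a DICTIONARY∕CONSISTENCY row, not an estimate of print: `F` ↔ print's s(Δ)-dependent operator products ((1.10)∕(1.23)∕(2.7)∕(2.14)) and `R_j`,
`r_j` ↔ a neighbourhood of (1.23)'s σ(Δ)-circles are TYPE READINGS; the hypothesis is JOINT analyticity on an OPEN POLYDISC (`AnalyticOnNhd`, print's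
word «analytic»; Mathlib has no Osgood lemma for `ℂⁿ`, so W43's `DifferentiableOn` hypothesis is NOT recovered — SAID); no numeral of
[Balaban1988RGII] asserted (k2) — `2`, `3∕2`, `1∕12` are OUR decided toy's numbers; (B1) for Bałaban's (2.14) NOT discharged; (B3) = GAPS G-ne9p2-5
UNPRINTED — NOT discharged, untouched; (B5) untouched; 0 binders instantiated on Bałaban's densities ∕ operators ∕ (2.14) data ∕ `d_k` ∕ minimisers ∕
backgrounds; discharges no wall item; wall v1.8 (T4-DAG v48) does NOT move; R-t4r2-Q2 NOT met thereby; NE1′ ⇐ the named binders — NOT proved, NOT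
printed; spine PROVED 0∕9; count 9 unchanged.  Rung (B)+1 on ONE finite four-torus — NOT infinite volume, NOT a mass gap, NOT OS on ℝ⁴, NOT Clay.
ABSOLUTE RULE honoured: the quotations are LOCI of the audited manuscript [Balaban1988RGII] (CMP 116 (1988) 1–22, pp. 6, 15), TYPE∕CONTEXT only,
never hypothesis-free facts; [Dimock2013] enters only through the cite-tagged Literature module BY NAME; nothing internally minted is cited;
[folklore] tags on kernel lemmas only.  HONEST DEPENDENCY: continuum YM on T⁴ ⇐ BetaPertH ∧ nine spine estimates (0/9 proved); BetaPertH ⇐ (D1)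
∧ (D4) ∧ CAP+tail; G-an2-4 gates asym, D1 and NE2/3/4.
-/

noncomputable section

namespace Summit.QuantumFields.BalabanUV.T4Continuum.NE1p.DressedSmallFieldMixedDerivativeSplitLocal

open MeasureTheory Metric Set Complex Finset Function Summit.QuantumFields.BalabanUV.T4Continuum.B13TermContours
open Summit.QuantumFields.BalabanUV.T4Continuum.NE1p.DressedSmallFieldMixedLetter Summit.QuantumFields.BalabanUV.T4Continuum.NE1p.DressedSmallFieldMixedDerivativeBridge
open Summit.QuantumFields.BalabanUV.T4Continuum.NE1p.DressedSmallFieldMixedDerivativeLetter Summit.QuantumFields.BalabanUV.T4Continuum.NE1p.DressedSmallFieldMixedDerivativeFTC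
open Summit.QuantumFields.BalabanUV.T4Continuum.NE1p.DressedSmallFieldMixedDerivativeSplit Summit.QuantumFields.BalabanUV.T4Continuum.NE1p.DressedSmallFieldMixedDerivativeLetterLocal
open Summit.QuantumFields.BalabanUV.T4Continuum.NE1p.DressedSmallFieldMixedLetterLocal (continuous_σS σS_mem_pi)
open Literature.MathematicalPhysics.QuantumFieldTheory.Dimock2011to13.PolydiscCauchyBounds (mixedDeriv analyticOnNhd_mixedDeriv polydisc lemma19_cauchy)

variable {n : ℕ}

/-! ## §1 Plumbing on the open polydisc `Π_j {|z_j| < R_j}`, `R_j > 1` -/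

/-- [folklore] The clamped base point lies in the open polydisc of radii `> 1` — for EVERY `s ∈ ℝⁿ` (the clamp keeps it in `[0,1]` on the active
cubes; W57 `basePt_mem_pi` at `interp ∘ s`). -/
theorem cubePt_mem_pi {R : Fin n → ℝ} (hR1 : ∀ j, 1 < R j) (S : Finset (Fin n)) (s : Fin n → ℝ) :
    cubePt S s ∈ Set.univ.pi fun j => ball (0 : ℂ) (R j) :=
  basePt_mem_pi hR1 S fun j _ => ⟨interp_nonneg (s j), interp_le_one (s j)⟩

/-- [folklore] Dimock's `∂_{enumS S} F` read at the clamped point is continuous in `s`, for `F` analytic on the open polydisc (`analyticOnNhd_mixedDeriv`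
on the OPEN polydisc BY NAME, composed with the continuous clamp whose range stays inside). -/
theorem continuous_mixedDeriv_cubePt_local {R : Fin n → ℝ} (hR1 : ∀ j, 1 < R j) (S : Finset (Fin n)) {F : (Fin n → ℂ) → ℂ}
    (hF : AnalyticOnNhd ℂ F (Set.univ.pi fun j => ball (0 : ℂ) (R j))) :
    Continuous fun s => mixedDeriv (enumS n S) F (cubePt S s) :=
  (analyticOnNhd_mixedDeriv (isOpen_polyBall R) hF (enumS n S)).continuousOn.comp_continuous (continuous_cubePt S)
    fun s => cubePt_mem_pi hR1 S s

/-- [folklore] **THE LOCAL INTEGRAND IS INTEGRABLE**: continuous (above) and bounded — the clamped point ranges in the compact CLOSED UNIT polydisc,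
which sits inside the open polydisc of radii `> 1`, where `∂_{enumS S} F` is continuous. -/
theorem integrable_mixedDeriv_cubePt_local {R : Fin n → ℝ} (hR1 : ∀ j, 1 < R j) (S : Finset (Fin n)) {F : (Fin n → ℂ) → ℂ}
    (hF : AnalyticOnNhd ℂ F (Set.univ.pi fun j => ball (0 : ℂ) (R j))) :
    Integrable (fun s => mixedDeriv (enumS n S) F (cubePt S s)) (Measure.pi (sS S)) := by
  have hA := analyticOnNhd_mixedDeriv (isOpen_polyBall R) hF (enumS n S)
  have hK : IsCompact (Set.univ.pi fun _ : Fin n => closedBall (0 : ℂ) 1) := isCompact_univ_pi fun _ => isCompact_closedBall _ _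
  have hKU : (Set.univ.pi fun _ : Fin n => closedBall (0 : ℂ) 1) ⊆ Set.univ.pi fun j => ball (0 : ℂ) (R j) :=
    Set.pi_mono fun j _ => closedBall_subset_ball (hR1 j)
  obtain ⟨B, hB⟩ := hK.exists_bound_of_continuousOn (hA.continuousOn.mono hKU)
  refine Integrable.mono' (integrable_const B) (continuous_mixedDeriv_cubePt_local hR1 S hF).measurable.aestronglyMeasurable
    (Filter.Eventually.of_forall fun s => hB _ ?_)
  exact Set.mem_univ_pi.2 fun j => mem_closedBall_zero_iff.2 (norm_cubePt_le S s j)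

/-! ## §2 THE FTC IN THE DECOUPLING PARAMETERS ON PRINT's ANALYTICITY DOMAIN -/

/-- **THE `s`-INTEGRAL OF DIMOCK's `∂_S` OVER THE UNIT CUBE IS `Δ_S` — LOCAL HYPOTHESIS** (kernel; W62's induction along `Fin.cons` with W57's
locality plumbing BY NAME: Fubini head-inside, on an ACTIVE head cube the one-variable FTC `intervalIntegral.integral_eq_sub_of_hasDerivAt` on the
head section `z ↦ ∂_{enumS S′}(F(z ∷ ·))(p′)`, holomorphic on the DISC `|z| < R₀ ⊃ [0,1]` (W57 `differentiableOn_mixedDeriv_cons`), restricted to the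
segment by `HasDerivAt.comp_ofReal`; on an INACTIVE one `integral_dirac`; sections at `c = 1, 0` analytic on the tail polydisc by W57
`analyticOnNhd_cons_section_local`): for radii `R_j > 1` and `F` JOINTLY ANALYTIC ON THE OPEN POLYDISC `Π_j {|z_j| < R_j}` ONLY,
`∫ ∂_{enumS S} F (cubePt S s) d(⨂_j sS S j)(s) = Δ_S F`. [folklore] -/
theorem integral_mixedDeriv_cubePt_eq_mixedDiff_local : ∀ (n : ℕ) (R : Fin n → ℝ) (S : Finset (Fin n)) (F : (Fin n → ℂ) → ℂ),
    (∀ j, 1 < R j) → AnalyticOnNhd ℂ F (Set.univ.pi fun j => ball (0 : ℂ) (R j)) →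
    ∫ s, mixedDeriv (enumS n S) F (cubePt S s) ∂(Measure.pi (sS S)) = mixedDiff n S F
  | 0, R, S, F, _, _ => by
      rw [Measure.pi_of_empty (sS S), integral_dirac]
      unfold cubePt
      rw [mixedDeriv_enumS_zero]
      rfl
  | n + 1, R, S, F, hR1, hF => by
      have hR1' : ∀ j, 1 < Fin.tail R j := fun j => hR1 j.succ
      set G : (Fin (n + 1) → ℝ) → ℂ := fun s => mixedDeriv (enumS (n + 1) S) F (cubePt S s) with hG
      have hGi : Integrable G (Measure.pi (sS S)) := integrable_mixedDeriv_cubePt_local hR1 S hF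
      -- Fubini along `Fin.cons`, the HEAD variable integrated inside
      have hmp := (measurePreserving_piFinSuccAbove (sS S) 0).symm
      have hpi : (fun j : Fin n => sS S (Fin.succAbove 0 j)) = sS (tailSet S) := by
        funext j; rw [Fin.succAbove_zero]; exact sS_succ S j
      rw [hpi] at hmp
      have he : ∀ q : ℝ × (Fin n → ℝ),
          (MeasurableEquiv.piFinSuccAbove (fun _ : Fin (n + 1) => ℝ) 0).symm q = Fin.cons q.1 q.2 := by
        intro q
        simp only [MeasurableEquiv.piFinSuccAbove_symm_apply, Fin.insertNthEquiv, Fin.insertNth_zero, Equiv.coe_fn_mk]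
        rfl
      have h1 : ∫ s, G s ∂(Measure.pi (sS S)) = ∫ q, G (Fin.cons q.1 q.2) ∂((sS S 0).prod (Measure.pi (sS (tailSet S)))) := by
        rw [← hmp.integral_comp']
        exact integral_congr_ae (Filter.Eventually.of_forall fun q => by dsimp only; rw [he])
      have hint : Integrable (fun q : ℝ × (Fin n → ℝ) => G (Fin.cons q.1 q.2)) ((sS S 0).prod (Measure.pi (sS (tailSet S)))) :=
        ((hmp.integrable_comp hGi.aestronglyMeasurable).2 hGi).congr
          (Filter.Eventually.of_forall fun q => by simp only [Function.comp_apply, he])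
      rw [h1, integral_prod_symm _ hint]
      dsimp only
      -- the two sections (head values `1`, `0` lie in the head disc `|z| < R 0`) and their induction hypotheses
      have hsec : ∀ {c : ℂ}, ‖c‖ < R 0 →
          AnalyticOnNhd ℂ (fun w : Fin n → ℂ => F (Fin.cons c w)) (Set.univ.pi fun j => ball (0 : ℂ) (Fin.tail R j)) :=
        fun hc => analyticOnNhd_cons_section_local hF hc
      have hc1 : ‖(1 : ℂ)‖ < R 0 := by simpa using hR1 0
      have hc0 : ‖(0 : ℂ)‖ < R 0 := by simpa using zero_lt_one.trans (hR1 0)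
      have IH : ∀ {c : ℂ}, ‖c‖ < R 0 → ∫ z, mixedDeriv (enumS n (tailSet S)) (fun w => F (Fin.cons c w)) (cubePt (tailSet S) z)
          ∂(Measure.pi (sS (tailSet S))) = mixedDiff n (tailSet S) (fun w => F (Fin.cons c w)) :=
        fun hc => integral_mixedDeriv_cubePt_eq_mixedDiff_local n (Fin.tail R) (tailSet S) _ hR1' (hsec hc)
      by_cases h0 : (0 : Fin (n + 1)) ∈ S
      · -- ACTIVE head cube: the inner integral is `∫₀¹ (d∕dx) M_z(x) dx = M_z(1) − M_z(0)` by the one-variable FTC on the head DISC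
        have hμ0 : sS S 0 = volume.restrict (Icc (0 : ℝ) 1) := if_pos h0
        have hinner : ∀ z : Fin n → ℝ, ∫ x, G (Fin.cons x z) ∂(sS S 0) =
            mixedDeriv (enumS n (tailSet S)) (fun w => F (Fin.cons 1 w)) (cubePt (tailSet S) z) -
              mixedDeriv (enumS n (tailSet S)) (fun w => F (Fin.cons 0 w)) (cubePt (tailSet S) z) := by
          intro z
          set p := cubePt (tailSet S) z with hp
          set M : ℂ → ℂ := fun w => mixedDeriv (enumS n (tailSet S)) (fun v => F (Fin.cons w v)) p with hM
          have hMd : DifferentiableOn ℂ M (ball (0 : ℂ) (R 0)) :=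
            differentiableOn_mixedDeriv_cons hF _ (cubePt_mem_pi hR1' (tailSet S) z)
          have hGx : ∀ x : ℝ, G (Fin.cons x z) = deriv M ((interp x : ℝ) : ℂ) := by
            intro x
            have key := mixedDeriv_enumS_succ_of_mem h0 F (fun j => interp ((Fin.cons x z : Fin (n + 1) → ℝ) j))
            have ht : (Fin.tail fun j => interp ((Fin.cons x z : Fin (n + 1) → ℝ) j)) = fun j => interp (z j) := by
              funext j; simp [Fin.tail]
            rw [ht] at key
            simp only [Fin.cons_zero] at key
            simpa [hG, hM, hp, cubePt] using key
          rw [hμ0]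
          simp_rw [hGx]
          rw [integral_Icc_eq_integral_Ioc, ← intervalIntegral.integral_of_le zero_le_one]
          have hcongr : ∫ x in (0 : ℝ)..1, deriv M ((interp x : ℝ) : ℂ) = ∫ x in (0 : ℝ)..1, deriv M (x : ℂ) := by
            refine intervalIntegral.integral_congr fun x hx => ?_
            rw [Set.uIcc_of_le zero_le_one] at hx
            simp only [interp_eq_self hx.1 hx.2]
          rw [hcongr]
          -- the real segment `[0,1]` lies in the head disc `|z| < R 0`
          have hseg : ∀ x ∈ uIcc (0 : ℝ) 1, (x : ℂ) ∈ ball (0 : ℂ) (R 0) := fun x hx => by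
            rw [Set.uIcc_of_le zero_le_one] at hx
            rw [mem_ball_zero_iff, Complex.norm_real, Real.norm_of_nonneg hx.1]
            exact lt_of_le_of_lt hx.2 (hR1 0)
          have hderiv : ∀ x ∈ uIcc (0 : ℝ) 1, HasDerivAt (fun t : ℝ => M t) (deriv M x) x := fun x hx =>
            ((hMd _ (hseg x hx)).differentiableAt (isOpen_ball.mem_nhds (hseg x hx))).hasDerivAt.comp_ofReal
          have hcd : ContinuousOn (deriv M) (ball (0 : ℂ) (R 0)) := (hMd.contDiffOn isOpen_ball).continuousOn_deriv_of_isOpen isOpen_ball le_top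
          have hcont : ContinuousOn (fun t : ℝ => deriv M t) (uIcc (0 : ℝ) 1) :=
            hcd.comp Complex.continuous_ofReal.continuousOn fun x hx => hseg x hx
          rw [intervalIntegral.integral_eq_sub_of_hasDerivAt hderiv hcont.intervalIntegrable]
          simp [hM]
        simp_rw [hinner]
        rw [integral_sub (integrable_mixedDeriv_cubePt_local hR1' (tailSet S) (hsec hc1))
          (integrable_mixedDeriv_cubePt_local hR1' (tailSet S) (hsec hc0)), IH hc1, IH hc0]
        simp only [mixedDiff, if_pos h0]
      · -- INACTIVE head cube: Dirac at `0`, the section at the decoupled value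
        have hμ0 : sS S 0 = Measure.dirac 0 := if_neg h0
        have hinner : ∀ z : Fin n → ℝ, ∫ x, G (Fin.cons x z) ∂(sS S 0) =
            mixedDeriv (enumS n (tailSet S)) (fun w => F (Fin.cons 0 w)) (cubePt (tailSet S) z) := by
          intro z
          rw [hμ0, integral_dirac, hG]
          have key := mixedDeriv_enumS_succ_of_not_mem h0 F (fun j => interp ((Fin.cons (0 : ℝ) z : Fin (n + 1) → ℝ) j))
          have ht : (Fin.tail fun j => interp ((Fin.cons (0 : ℝ) z : Fin (n + 1) → ℝ) j)) = fun j => interp (z j) := by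
            funext j; simp [Fin.tail]
          rw [ht] at key
          simpa [cubePt] using key
        simp_rw [hinner]
        rw [IH hc0]
        simp only [mixedDiff, if_neg h0]

/-- **… AT THE UNCLAMPED POINT** (§2 + W70 `cubePt_ae_eq_basePt`): `∫ ∂_{enumS S} F (basePt S s) d(⨂ sS S) = Δ_S F`, local hypothesis. [folklore] -/
theorem integral_mixedDeriv_basePt_eq_mixedDiff_local {R : Fin n → ℝ} (hR1 : ∀ j, 1 < R j) (S : Finset (Fin n)) (F : (Fin n → ℂ) → ℂ)
    (hF : AnalyticOnNhd ℂ F (Set.univ.pi fun j => ball (0 : ℂ) (R j))) :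
    ∫ s, mixedDeriv (enumS n S) F (basePt S s) ∂(Measure.pi (sS S)) = mixedDiff n S F := by
  rw [← integral_mixedDeriv_cubePt_eq_mixedDiff_local n R S F hR1 hF]
  exact integral_congr_ae ((cubePt_ae_eq_basePt S).mono fun s (hs : cubePt S s = basePt S s) => by
    show mixedDeriv (enumS n S) F (basePt S s) = mixedDeriv (enumS n S) F (cubePt S s)
    rw [hs])

/-! ## §3 THE THREE ROUTES COMMUTE LOCALLY: contour radii `1 < r_j < R_j` -/

/-- **W57 AT EVERY PARAMETER, READ THROUGH THE CLAMP** (W57 `mixedDerivLetter_rep_local` ONCE at `interp ∘ s`, moved back by W70's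
`wS_pairθ_interp`∕`σS_pairθ`): `∫ wS r S (s,θ)·F(σ_S(s,θ)) d(⨂ θS S)(θ) = ∂_{enumS S} F (cubePt S s)` for EVERY `s ∈ ℝⁿ`, local hypothesis. [folklore] -/
theorem angularLetter_eq_mixedDeriv_cubePt_local {r R : Fin n → ℝ} (hr : ∀ j, 1 < r j) (hR : ∀ j, r j < R j) (S : Finset (Fin n))
    (F : (Fin n → ℂ) → ℂ) (hF : AnalyticOnNhd ℂ F (Set.univ.pi fun j => ball (0 : ℂ) (R j))) (s : Fin n → ℝ) :
    ∫ θ, wS r S (pairθ s θ) * F (σS r S (pairθ s θ)) ∂(Measure.pi (θS S)) = mixedDeriv (enumS n S) F (cubePt S s) := by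
  have h := mixedDerivLetter_rep_local n r R S F (fun j => interp (s j)) hr hR hF fun j _ => ⟨interp_nonneg _, interp_le_one _⟩
  simp_rw [wS_pairθ_interp r S s, σS_pairθ r S s (fun j => interp (s j))]
  exact h

/-- [folklore] W39.1's integrand is integrable against `⨂ μS S` for radii `1 < r_j < R_j` and `F` analytic on the open polydisc (continuous on the
configurations, which stay in the compact polydisc of radii `r` inside the open one — W43's step, as a lemma). -/
theorem integrable_letter_local {r R : Fin n → ℝ} (hr : ∀ j, 1 < r j) (hR : ∀ j, r j < R j) (S : Finset (Fin n)) {F : (Fin n → ℂ) → ℂ}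
    (hF : AnalyticOnNhd ℂ F (Set.univ.pi fun j => ball (0 : ℂ) (R j))) :
    Integrable (fun p => wS r S p * F (σS r S p)) (Measure.pi (μS S)) := by
  have hr0 : ∀ j, 0 ≤ r j := fun j => zero_le_one.trans (hr j).le
  have hFσ : Continuous fun p : Fin n → ℝ × ℝ => F (σS r S p) :=
    hF.continuousOn.comp_continuous (continuous_σS r S) fun p => σS_mem_pi hr0 hR S p
  have hGm : Measurable fun p => wS r S p * F (σS r S p) := (measurable_wS r S).mul hFσ.measurable
  obtain ⟨B, hB⟩ : ∃ B, ∀ p, ‖F (σS r S p)‖ ≤ B := by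
    have hK : IsCompact (Set.univ.pi fun j : Fin n => closedBall (0 : ℂ) (r j)) := isCompact_univ_pi fun j => isCompact_closedBall _ _
    obtain ⟨B, hB⟩ := hK.exists_bound_of_continuousOn
      (hF.continuousOn.mono (Set.pi_mono fun j _ => closedBall_subset_ball (hR j)))
    exact ⟨B, fun p => hB _ (Set.mem_univ_pi.2 fun j => mem_closedBall_zero_iff.2 (norm_σS_le hr0 S p j))⟩
  refine Integrable.mono' (integrable_const ((∏ j, max (wB₁ (r j)) 1) * B)) hGm.aestronglyMeasurable
    (Filter.Eventually.of_forall fun p => ?_)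
  rw [norm_mul]
  exact mul_le_mul (norm_wS_le hr S p) (hB p) (norm_nonneg _) (Finset.prod_nonneg fun _ _ => zero_le_one.trans (le_max_right _ _))

/-- **W39.1's LETTER = `∫ ds` OF DIMOCK's DERIVATIVE, LOCAL HYPOTHESIS** (W70's split `integral_μS_eq_integral_sS_θS` ONCE + §3's first lemma
under the outer integral): `∫ wS·F∘σS d(⨂ μS S) = ∫ ∂_{enumS S} F (cubePt S s) d(⨂ sS S)(s)`. [folklore] -/
theorem mixedLetter_eq_integral_mixedDeriv'_local {r R : Fin n → ℝ} (hr : ∀ j, 1 < r j) (hR : ∀ j, r j < R j) (S : Finset (Fin n))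
    (F : (Fin n → ℂ) → ℂ) (hF : AnalyticOnNhd ℂ F (Set.univ.pi fun j => ball (0 : ℂ) (R j))) :
    ∫ p, wS r S p * F (σS r S p) ∂(Measure.pi (μS S)) = ∫ s, mixedDeriv (enumS n S) F (cubePt S s) ∂(Measure.pi (sS S)) := by
  rw [integral_μS_eq_integral_sS_θS S (integrable_letter_local hr hR S hF)]
  simp_rw [angularLetter_eq_mixedDeriv_cubePt_local hr hR S F hF]

/-- **THE THREE ROUTES COMMUTE LOCALLY — W43's REPRESENTATION RE-DERIVED** (§3 + §2; CENSUS: W43's `mixedLetter_rep_local`, W39.1's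
`mixedLetter_rep` and W62's entire FTC are used NOWHERE in this file): for radii `1 < r_j < R_j` and `F` analytic on the open polydisc
`Π_j {|z_j| < R_j}`, `∫ wS·F∘σS d(⨂ μS S) = Δ_S F` — contours at fixed `s` (W57), then `∫ ds` of Dimock's derivative (§2), land on Bałaban's mixed
difference on print's analyticity domain.  (W43 has `F` ℂ-differentiable on the polydisc; analytic ⇒ that, the converse (Osgood) is not in Mathlib.) -/
theorem mixedLetter_rep_of_split_local {r R : Fin n → ℝ} (hr : ∀ j, 1 < r j) (hR : ∀ j, r j < R j) (S : Finset (Fin n))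
    (F : (Fin n → ℂ) → ℂ) (hF : AnalyticOnNhd ℂ F (Set.univ.pi fun j => ball (0 : ℂ) (R j))) :
    ∫ p, wS r S p * F (σS r S p) ∂(Measure.pi (μS S)) = mixedDiff n S F := by
  rw [mixedLetter_eq_integral_mixedDeriv'_local hr hR S F hF,
    integral_mixedDeriv_cubePt_eq_mixedDiff_local n R S F (fun j => (hr j).trans (hR j)) hF]

/-- [folklore] §2's ENTIRE case (W62's statement) is the special case of any radii `R > 1`. -/
example (S : Finset (Fin n)) (F : (Fin n → ℂ) → ℂ) (hF : AnalyticOnNhd ℂ F univ) :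
    ∫ s, mixedDeriv (enumS n S) F (cubePt S s) ∂(Measure.pi (sS S)) = mixedDiff n S F :=
  integral_mixedDeriv_cubePt_eq_mixedDiff_local n (fun _ => 2) S F (fun _ => by norm_num) (hF.mono (subset_univ _))

/-! ## §4 (2.15)'s FIRST FACTOR FOR THE DIFFERENCE `Δ_S` BY THE DERIVATIVE ROUTE: Dimock's Lemma 19 through the FTC -/

/-- **`‖Δ_S F‖ ≤ A·e^{−(κ₁−1)·#S}` — BAŁABAN's DIFFERENCE BOUNDED BY DIMOCK's LEMMA 19 THROUGH THE CUBE INTEGRAL** (§2 + `lemma19_cauchy` BY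
NAME at the clamped point — which lies in the closed unit polydisc, `norm_cubePt_le` — + mass one of the interpolation cube, W70 `pi_sS_univ`):
for `1 ≤ κ₁`, `F` analytic on an open polydisc of radii `R_j > e^{κ₁}` and bounded by `A` on the closed polydisc `|z_j| ≤ e^{κ₁}` (a HYPOTHESIS of
(1.18)∕(1.21) TYPE), `‖Δ_S F‖ ≤ A·e^{−(κ₁−1)·#S}` — the shape of (2.15)'s∕(1.24)'s «exp(−(κ₁ − 1)·#cubes)» (TYPE) for the DIFFERENCE form, reached
through the derivative route (W39.1's `mixedLetter_decay_le` reaches it through the contours with the bound on the torus `|σ_j| = e^{κ₁}`). [folklore] -/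
theorem norm_mixedDiff_le_lemma19 {R : Fin n → ℝ} {κ₁ A : ℝ} (hκ : 1 ≤ κ₁) (hR : ∀ j, Real.exp κ₁ < R j) (S : Finset (Fin n))
    {F : (Fin n → ℂ) → ℂ} (hF : AnalyticOnNhd ℂ F (Set.univ.pi fun j => ball (0 : ℂ) (R j)))
    (hA : ∀ z ∈ polydisc (fun _ : Fin n => Real.exp κ₁), ‖F z‖ ≤ A) :
    ‖mixedDiff n S F‖ ≤ A * Real.exp (-((κ₁ - 1) * S.card)) := by
  have h1 : ∀ j, 1 < R j := fun j => lt_trans (by have := Real.add_one_le_exp κ₁; linarith) (hR j)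
  have hRU : polydisc (fun _ : Fin n => Real.exp κ₁) ⊆ Set.univ.pi fun j => ball (0 : ℂ) (R j) :=
    fun z hz => Set.mem_univ_pi.2 fun j => mem_ball_zero_iff.2 (lt_of_le_of_lt (hz j) (hR j))
  have hpt : ∀ s : Fin n → ℝ, ‖mixedDeriv (enumS n S) F (cubePt S s)‖ ≤ A * Real.exp (-((κ₁ - 1) * S.card)) := fun s => by
    have h := lemma19_cauchy (isOpen_polyBall R) hF hκ hRU hA (enumS_nodup n S) (s := cubePt S s) fun j => norm_cubePt_le S s j
    rwa [length_enumS, neg_mul] at h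
  rw [← integral_mixedDeriv_cubePt_eq_mixedDiff_local n R S F h1 hF]
  refine (norm_integral_le_integral_norm _).trans ?_
  calc ∫ s, ‖mixedDeriv (enumS n S) F (cubePt S s)‖ ∂(Measure.pi (sS S))
      ≤ ∫ _s, A * Real.exp (-((κ₁ - 1) * S.card)) ∂(Measure.pi (sS S)) :=
        integral_mono_of_nonneg (Filter.Eventually.of_forall fun _ => norm_nonneg _) (integrable_const _)
          (Filter.Eventually.of_forall hpt)
    _ = A * Real.exp (-((κ₁ - 1) * S.card)) := by rw [integral_const, measureReal_def, pi_sS_univ, ENNReal.toReal_one, one_smul]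

/-! ## §5 Decided checks on W57's NON-ENTIRE factor `(4 − z₀z₁)⁻¹` — where W62∕W70's entire theorems are silent -/

/-- DECIDED CHECK (local FTC): `∫_{[0,1]²} ∂₀∂₁ (4 − s₀s₁)⁻¹ ds = Δ_{01}(4 − z₀z₁)⁻¹ = (4−1)⁻¹ − (4−0)⁻¹ − ((4−0)⁻¹ − 4⁻¹) = 1∕12` — §2 at radius `2` for a
factor that is NOT entire (W57 `not_analyticOnNhd_univ_inv_four_sub`), + W39.1 `mixedDiff_pair`. -/
example : ∫ s, mixedDeriv (enumS 2 {0, 1}) (fun z : Fin 2 → ℂ => (4 - z 0 * z 1)⁻¹) (cubePt {0, 1} s) ∂(Measure.pi (sS {0, 1})) = 1 / 12 := by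
  rw [integral_mixedDeriv_cubePt_eq_mixedDiff_local 2 (fun _ => 2) {0, 1} _ (fun _ => by norm_num) analyticOnNhd_inv_four_sub, mixedDiff_pair]
  norm_num

/-- DECIDED CHECK (local commuting routes): W39.1's full iterated letter of the NON-ENTIRE `(4 − σ₀σ₁)⁻¹` at contour radii `3∕2 < 2` on both cubes
IS `1∕12` — through W57 (inner contours) + §2 (outer `ds`) + W70's split; no entire theorem applies. -/
example : ∫ p : Fin 2 → ℝ × ℝ, wS (fun _ => (3 / 2 : ℝ)) {0, 1} p *
    (4 - σS (fun _ => (3 / 2 : ℝ)) {0, 1} p 0 * σS (fun _ => (3 / 2 : ℝ)) {0, 1} p 1)⁻¹ ∂(Measure.pi (μS {0, 1})) = 1 / 12 := by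
  rw [mixedLetter_rep_of_split_local (n := 2) (R := fun _ => 2) (fun _ => by norm_num) (fun _ => by norm_num) {0, 1}
    (fun z : Fin 2 → ℂ => (4 - z 0 * z 1)⁻¹) analyticOnNhd_inv_four_sub, mixedDiff_pair]
  norm_num

end Summit.QuantumFields.BalabanUV.T4Continuum.NE1p.DressedSmallFieldMixedDerivativeSplitLocal

end
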